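/-
Origin: expansion seat `prover-pub-hodgecm-mc-binder-1-g15-0`, handover #R96 2026-08-20T18:37:14Z md5 08e2d6011d46 (165 l.; NEW additive universe-free datum-generic leaf; imports #R95 only; drops ⇒ {#R97}; NAME LIST: HodgeCM.Model.HeckeHodgeType.map_levelProj_injective · HodgeCM.Model.HeckeHodgeType.pull_baseChange_injective · HodgeCM.Model.HeckeHodgeType.mem_F_one_of_pull_mem · HodgeCM.Model.HeckeHodgeType.heckeOpC_mem_hodge_F_one) (`HOME/mc/pub-hodgecm-mc-binder-1-g15/stage59/HodgeCM/Model/HeckeHodgeType.lean`, md5 08e2d6011d46, 165 lines);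
landed by the gen-24 packager (p-g24) in gate run 59 as `HodgeCM/Model/HeckeHodgeType.lean` (verbatim).
-/
/-
Copyright (c) 2026 the pub-hodgecm formalisation cell (harness21).  New file, not vendored.
Origin: session prover-pub-hodgecm-mc-binder-1-g15-0 (unit pub-hodgecm-mc-binder-1-g15, BINDER PROVER gen 15 of lineage mc-binder-1;
content lane (J-Liu-Θ), scope memo `HOME/mc/pub-hodgecm-mc-binder-1-g14/JLIU-THETA-SCOPE.md` §9 (J2), HECKE-TOWER sub-leaf (T4):
«Hecke operators preserve `F¹H¹` — the holomorphic one-forms»), 2026-08-20.  Intended final place: `HodgeCM/Model/HeckeHodgeType.lean`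
(NEW additive leaf, universe-free, datum-generic; imports ONLY `HodgeCM.Model.LevelCoverAlgebraic` (this seat, same kit); nothing imports it;
drops with `LevelCoverAlgebraic`).
-/
import Summits.HodgeConjecture.HodgeCM.Model.LevelCoverAlgebraic

set_option autoImplicit false

/-!
# Hecke operators preserve the Hodge filtration step `F¹H¹` (the holomorphic one-forms)

For a compact ball quotient `X(ℂ) ≅ Γ\𝔹` with datum `D : UnitaryBallQuotientDatum p X` and `g` admissible, GIVEN an algebraic model of the
Hecke level cover — a ball uniformization `DN'` of a smooth projective `XN'` by the same hermitian space with group `N_g` (`Γ_{N'}^{τ₁} = N_g^{τ₁}`),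
the algebraic projection `π : XN' ⟶ X` over the uniformizations and the algebraic translates `π_q : XN' ⟶ X` over `v ↦ g γ̃_q v` (all of which
the model universe supplies: (ii-a) `BallQuotientUniformised` for `XN'`, glue-1's `coverOf` for `π`, `LevelCoveringTwist` for `π_q`) — the Hecke
operator `T_g` (#R89 `heckeOpC`, currency `ℂ ⊗ H¹(X(ℂ); ℚ)`) maps `F¹H¹(X)` into itself:

* `map_levelProj_injective` — `π^* : Hᵏ(X(ℂ); ℂ) → Hᵏ(N\𝔹; ℂ)` along a finite Galois level cover is injective (transfer: `τ π^* = |Γ/N|`,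
  vendored `FiniteDeckCover.card_smul_eq_zero_of_map_eq_zero`, and `|Γ/N| ≠ 0` in `ℂ`); hence (`levelHomeo`) so is `π(ℂ)^*` for the algebraic
  model (`map_mapContinuous_injective`) and its rational form `(pull π k)_ℂ` (`pull_baseChange_injective`, naturality + injectivity of `β`);
* `mem_F_one_of_pull_mem` — **`F¹` is detected by an injective pull-back**: if `(π^*)_ℂ y ∈ F¹H¹(XN')` then `y ∈ F¹H¹(X)` — write `y = a + b` with
  `a ∈ F¹`, `b ∈ F̄¹` (the weight-one Hodge structure: `F¹ ⊕ F̄¹ = H¹_ℂ`, field `isCompl_F_complexConj` of the tree's `HodgeStructure`); `π^*`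
  commutes with `conj` (`conj_baseChange`) and preserves `F¹` (`BettiUniverse.pull_hodge`, over `hI`), so `π^* b ∈ F¹ ∩ F̄¹ = 0`, and `b = 0`;
* `heckeOpC_mem_hodge_F_one` — **`T_g F¹H¹(X) ⊆ F¹H¹(X)`**: `π^*(T_g ω) = [Γ':N_g]⁻¹ Σ_q π_q^* ω` (`LevelCoverAlgebraic.pull_heckeOpC_eq_sum`) lies
  in `F¹H¹(XN')` by `pull_hodge`, and the previous item.

This is the Hodge-type half of (J2): with it, `classLift (T_g ω)` is computed by glue-1's `classLift_pull` at level `N_g` and equals, by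
`ClassLiftTwist.classLift_pull_mulVec` + sinst-1's `BallFormsHecke`, the section-level Hecke operator applied to `classLift ω` (assembly leaf, next).
KIND: kernel theorems over vendored tree modules and this lane's leaves; the two PRINT-backed hypotheses are the cell's standing `hHD`/`hI` rows;
nothing cited anew, nothing minted; 0 proof holes; expected `#print axioms` ⊆ {propext, Classical.choice, Quot.sound}.

References: A. Hatcher, *Algebraic Topology* (2002), §3.G Prop. 3G.1; C. Voisin, *Hodge Theory and Complex Algebraic Geometry I* (2002), §7.1.1
(Def. 7.3/7.4: `F¹ ⊕ F̄¹` in weight one), §7.3.2 (pull-backs are morphisms of Hodge structures); G. Shimura (1971), §8.3 (Hecke operators on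
holomorphic differentials).
-/

noncomputable section

open MulAction Function Set
open scoped TensorProduct
open CategoryTheory
open Literature.AlgebraicGeometry.HodgeTheory
open Literature.AlgebraicGeometry.Motives (SchemeOver ComplexPoints AlgPoints bettiCohomology ofRatClassBaseChange IsSmoothProjective)
open Literature.AlgebraicGeometry.Motives.HodgeStructure (conj complexConj mem_complexConj conj_baseChange)
open Literature.AlgebraicTopology.SingularHomology

namespace HodgeCM.Model.HeckeHodgeType

open Literature.AlgebraicGeometry.ShimuraVarieties UnitaryBallQuotientDatum
open HodgeCM.Model.LevelCoverAlgebraic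

variable {p : ℕ} {X XN : SchemeOver ℂ} (D : UnitaryBallQuotientDatum p X)

/-! ### Pull-back along a finite Galois level cover is injective -/

/-- **`π^*` along a finite Galois level cover is injective on `Hᵏ(·; ℂ)`** (`τ π^* = |Γ/N|`, and `|Γ/N| ≠ 0` in `ℂ`).
[cite: HatcherAT2002, §3.G Prop. 3G.1] -/
theorem map_levelProj_injective (N : Subgroup ↥D.Γ) [N.Normal] [Fintype (↥D.Γ ⧸ N)] (hcov : IsCoveringMap (D.levelProj N)) (k : ℕ) :
    Injective (singularCohomology.map ℂ ℂ (D.levelProj N) k) := by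
  rw [injective_iff_map_eq_zero]
  intro x hx
  have h := (D.levelDeckCover N hcov).card_smul_eq_zero_of_map_eq_zero k (x := x) hx
  rw [← Nat.cast_smul_eq_nsmul ℂ] at h
  exact (smul_eq_zero.1 h).resolve_left (Nat.cast_ne_zero.2 Fintype.card_ne_zero)

variable (N : Subgroup ↥D.Γ) (DN : UnitaryBallUniformisationDatum p XN) (hH : DN.Hℂ = D.Hℂ)
  (hΓ : DN.Γ.map (Matrix.GeneralLinearGroup.map DN.τ₁) = (N.map D.Γ.subtype).map (Matrix.GeneralLinearGroup.map D.τ₁))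

include hH hΓ in
/-- **`π(ℂ)^*` is injective for the algebraic model of a finite Galois level cover** (through `levelHomeo`: `π(ℂ) ∘ levelHomeo = levelProj N`).
[cite: HatcherAT2002, §3.G Prop. 3G.1] -/
theorem map_mapContinuous_injective [N.Normal] [Fintype (↥D.Γ ⧸ N)] (hcov : IsCoveringMap (D.levelProj N))
    (π : XN ⟶ X) (hπ : ∀ v ∈ DN.cone, AlgPoints.map π (DN.unif v) = D.unif v) (k : ℕ) :
    Injective (singularCohomology.map ℂ ℂ (AlgPoints.mapContinuous (L := ℂ) π) k) := by
  have hinj := map_levelProj_injective D N hcov k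
  rw [← mapContinuous_comp_levelHomeo D N DN hH hΓ π hπ, singularCohomology.map_comp] at hinj
  exact Injective.of_comp hinj

include hH hΓ in
/-- … and so is its rational form `(pull π k)_ℂ` on `ℂ ⊗ Hᵏ(X(ℂ); ℚ)` (naturality of the complexification `β` and its injectivity).
[cite: HatcherAT2002, §3.G Prop. 3G.1] [cite: VoisinHodgeI2002, §7.1.1] -/
theorem pull_baseChange_injective [N.Normal] [Fintype (↥D.Γ ⧸ N)] (hcov : IsCoveringMap (D.levelProj N))
    (π : XN ⟶ X) (hπ : ∀ v ∈ DN.cone, AlgPoints.map π (DN.unif v) = D.unif v) (k : ℕ) :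
    Injective ((BettiUniverse.pull π k).baseChange ℂ) := by
  have h1 := map_mapContinuous_injective D N DN hH hΓ hcov π hπ k
  have h2 : Injective (singularCohomology.map ℂ ℂ (AlgPoints.mapContinuous (L := ℂ) π) k ∘ ofRatClassBaseChange (ComplexPoints X) k) :=
    h1.comp (ofRatClassBaseChange_injective _ k)
  have heq : (singularCohomology.map ℂ ℂ (AlgPoints.mapContinuous (L := ℂ) π) k ∘ ofRatClassBaseChange (ComplexPoints X) k) =
      ofRatClassBaseChange (ComplexPoints XN) k ∘ (BettiUniverse.pull π k).baseChange ℂ := by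
    funext t
    exact map_ofRatClassBaseChange _ k _ t
  rw [heq] at h2
  exact Injective.of_comp h2

/-! ### `F¹` of a weight-one Hodge structure is detected by an injective morphism -/

/-- **If `(π^*)_ℂ y ∈ F¹H¹(XN)` for an injective pull-back `π^*` then `y ∈ F¹H¹(X)`**: `y = a + b`, `a ∈ F¹`, `b ∈ F̄¹` (weight one:
`F¹ ⊕ F̄¹ = H¹_ℂ`); `π^* b = π^* y − π^* a ∈ F¹` and `π^* b ∈ F̄¹` (`π^*` commutes with `conj` and preserves `F¹`), so `π^* b ∈ F¹ ∩ F̄¹ = 0`.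
[cite: VoisinHodgeI2002, §7.1.1 and §7.3.2] -/
theorem mem_F_one_of_pull_mem (hHD : exists_isReal_hodgeModel) (hI : hodgePQ_independent_of_hodgeModel) {n m : ℕ}
    (hX : IsSmoothProjective n X) (hXN : IsSmoothProjective m XN) (π : XN ⟶ X) (hinj : Injective ((BettiUniverse.pull π 1).baseChange ℂ))
    {y : ℂ ⊗[ℚ] bettiCohomology X 1} (hy : (BettiUniverse.pull π 1).baseChange ℂ y ∈ (BettiUniverse.hodge hHD hXN 1).F 1) :
    y ∈ (BettiUniverse.hodge hHD hX 1).F 1 := by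
  set H := BettiUniverse.hodge hHD hX 1 with hHdef
  set HN := BettiUniverse.hodge hHD hXN 1 with hHNdef
  have hc : IsCompl (H.F 1) (complexConj (H.F 1)) := H.isCompl_F_complexConj 1 1 (by norm_num)
  have hcN : IsCompl (HN.F 1) (complexConj (HN.F 1)) := HN.isCompl_F_complexConj 1 1 (by norm_num)
  -- decompose `y = a + b`
  have hy_top : y ∈ H.F 1 ⊔ complexConj (H.F 1) := by rw [hc.sup_eq_top]; exact Submodule.mem_top
  obtain ⟨a, ha, b, hb, rfl⟩ := Submodule.mem_sup.1 hy_top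
  -- `π^*` preserves `F¹`
  have hpull : ∀ z ∈ H.F 1, (BettiUniverse.pull π 1).baseChange ℂ z ∈ HN.F 1 := fun z hz ↦
    BettiUniverse.pull_hodge hHD hI hXN hX π 1 1 (Submodule.mem_map_of_mem hz)
  -- `π^* b ∈ F¹ ∩ F̄¹ = 0`
  have hb1 : (BettiUniverse.pull π 1).baseChange ℂ b ∈ HN.F 1 := by
    have : (BettiUniverse.pull π 1).baseChange ℂ b = (BettiUniverse.pull π 1).baseChange ℂ (a + b) - (BettiUniverse.pull π 1).baseChange ℂ a := by
      rw [map_add, add_sub_cancel_left]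
    rw [this]
    exact Submodule.sub_mem _ hy (hpull a ha)
  have hb2 : (BettiUniverse.pull π 1).baseChange ℂ b ∈ complexConj (HN.F 1) := by
    rw [mem_complexConj, conj_baseChange]
    exact hpull _ (mem_complexConj.1 hb)
  have hb0 : (BettiUniverse.pull π 1).baseChange ℂ b = 0 := by
    have : (BettiUniverse.pull π 1).baseChange ℂ b ∈ HN.F 1 ⊓ complexConj (HN.F 1) := Submodule.mem_inf.2 ⟨hb1, hb2⟩
    rwa [hcN.inf_eq_bot, Submodule.mem_bot] at this
  have hb' : b = 0 := hinj (by rw [hb0, map_zero])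
  rw [hb', add_zero]
  exact ha

/-! ### Hecke operators preserve `F¹H¹` -/

variable {D}
variable {g : GL (Fin (p + 1)) D.E} (h : D.IsHeckeAdmissible g)
variable {XN' : SchemeOver ℂ} (DN' : UnitaryBallUniformisationDatum p XN')
  (hH' : DN'.Hℂ = D.Hℂ)
  (hΓ' : DN'.Γ.map (Matrix.GeneralLinearGroup.map DN'.τ₁) =
    ((D.heckeLevel g).map D.Γ.subtype).map (Matrix.GeneralLinearGroup.map D.τ₁))

include h hH' hΓ' in
/-- **Hecke operators preserve `F¹H¹`**: for `g` admissible, an algebraic model `(XN', DN', π, π_q)` of the Hecke level cover `N_g\𝔹 ⇉ Γ\𝔹` as in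
`LevelCoverAlgebraic.pull_heckeOpC_eq_sum`, and `ω ∈ F¹(ℂ ⊗ H¹(X(ℂ); ℚ))`: `T_g ω ∈ F¹`. [cite: Shimura1973, §8.3]
[cite: VoisinHodgeI2002, §7.3.2] -/
theorem heckeOpC_mem_hodge_F_one (hHD : exists_isReal_hodgeModel) (hI : hodgePQ_independent_of_hodgeModel) {n : ℕ}
    (hX : IsSmoothProjective n X) (π : XN' ⟶ X) (hπ : ∀ v ∈ DN'.cone, AlgPoints.map π (DN'.unif v) = D.unif v)
    (πq : ↥D.Γ ⧸ D.heckeLevel g → (XN' ⟶ X))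
    (hπq : ∀ q, ∀ v ∈ DN'.cone, v ∈ D.cone →
      AlgPoints.map (πq q) (DN'.unif v) = D.unif (D.act (g * ((Quotient.out q : ↥D.Γ) : GL (Fin (p + 1)) D.E)) v))
    {ω : ℂ ⊗[ℚ] bettiCohomology X 1} (hω : ω ∈ (BettiUniverse.hodge hHD hX 1).F 1) :
    heckeOpC D hX 1 g ω ∈ (BettiUniverse.hodge hHD hX 1).F 1 := by
  haveI : (D.heckeLevel g).FiniteIndex := h.finiteIndex
  letI : Fintype (↥D.Γ ⧸ D.heckeLevel g) := Subgroup.fintypeQuotientOfFiniteIndex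
  have hinj := pull_baseChange_injective D (D.heckeLevel g) DN' hH' hΓ' h.isCoveringMap π hπ 1
  refine mem_F_one_of_pull_mem hHD hI hX DN'.isSmoothProjective π hinj ?_
  have hsum := pull_heckeOpC_eq_sum h DN' hH' hΓ' hX π hπ πq hπq 1 ω
  rw [hsum]
  refine Submodule.smul_mem _ _ (Submodule.sum_mem _ fun q _ ↦ ?_)
  exact BettiUniverse.pull_hodge hHD hI DN'.isSmoothProjective hX (πq q) 1 1 (Submodule.mem_map_of_mem hω)

end HodgeCM.Model.HeckeHodgeType

end
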